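import Summits.CriticalPhenomena.PercolationContinuityZ3.Theorems.PercNearOneGluingNoHeavyQuantIndepBlobMergeToOneLight
import Summits.CriticalPhenomena.PercolationContinuityZ3.Theorems.PercNearOneGluingNoHeavyQuantIndepBlobClosureUnionBound
import Summits.CriticalPhenomena.PercolationContinuityZ3.Theorems.PercNearOneGluingNoHeavyQuantDIBStar
import HarnessLib

/-!
# QUANT lane R8, FAR on general trees: term certificates λ (one light blob, every floor), λ⁺ (several light blobs, all but one
# heavy-mergeable) and υ (closure union bound) for the root reduction

builds on p205010 (kernel theorem, internal audit signed; external expert review pending)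

Support file (`--supports stmt-CriticalPhenomena-4575`), QUANT lane seat prim-quant-p1 (gen 11); memo
`run/shared/lean/prim/quant/P1-SURPLUS.md` §22.  Theorems only; no definitions, no sorries, standard axioms.

Typer g17's root reduction (`…QuantRootReduction`, `…QuantDIBStar`; README V185/V189) writes the root tail of a tree instance as a mixture of
TERMS `TERM[s, a, g, j] = P(s + Σ_{k open} a k ≥ j+1)` and certifies each term at the floor `x` by one of the rules β/α/γ/ε (and μ, p1 g11
`…QuantRootDecGradedMerge`).  This file turns three rows of p1 g11 into term certificates (all at layer `j − s` via `RootDec.term_shift`):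

* λ `RootDec.term_ge_of_oneLight` — exactly one blob `x₀` below the floor (`x² ≤ g x₀ ≤ x`, `a x₀ ≤ j − s`), the others `≥ x`, and
  `2(j − s) < Σ_{k ≠ x₀} a k·g k + a x₀·(g x₀ − x²)/(1 − x)` ⟹ `x ≤ TERM` — DIB\* with one light blob at EVERY floor `0 < x < 1`
  (`IndepBlob.tail_ge_of_oneLight_allFloors`, `…QuantIndepBlobOneLightAllFloors`);
* λ⁺ `RootDec.term_ge_of_heavyMerge_oneLight` — the same with further sub-floor blobs that are heavy-mergeable at layer `j − s`
  (`IndepBlob.tail_ge_of_heavyMerge_oneLight`, `…QuantIndepBlobMergeToOneLight`);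
* υ `RootDec.term_ge_of_closureUnionBound` — `x ≤ 1 − Σ_{Z ∈ 𝓜} ∏_{k∈Z}(1 − g k)` for a family `𝓜` covering every failing configuration at
  layer `j − s` ⟹ `x ≤ TERM` (`IndepBlob.tail_ge_one_sub_closureUnionBound`, `…QuantIndepBlobClosureUnionBound`; numerically the complete
  certificate of the lumpy part of the DIB\* corner, memo §22.6).
[cite: KozmaNitzan2024, Conjecture 3 (p. 15)] (the gluing rows served); the certificates are [this work].
-/

namespace Summit.CriticalPhenomena.PercolationContinuityZ3.Theorems

namespace Quant

namespace RootDec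

open Finset

variable {κ : Type} [Fintype κ] [DecidableEq κ]

/-- product-Bernoulli weight of the set `W` of open blobs (as in `…QuantRootReduction`) -/
local notation3 "wt[" g ", " W "]" => ∏ k, (if k ∈ (W : Finset κ) then (g : κ → ℝ) k else 1 - (g : κ → ℝ) k)

/-- the TERM tail `P(s + Σ_{k open} a k ≥ j+1)` (as in `…QuantRootReduction`) -/
local notation3 "TERM[" s ", " a ", " g ", " j "]" =>
  ∑ W : Finset κ, wt[g, W] * (if (j : ℕ) + 1 ≤ (s : ℕ) + ∑ k ∈ W, (a : κ → ℕ) k then (1 : ℝ) else 0)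

/-- From the filter form at layer `j − s` to the term. -/
theorem term_ge_of_filter_ge (s : ℕ) (a : κ → ℕ) (g : κ → ℝ) (j : ℕ) (x : ℝ) (hsj : s ≤ j)
    (h : x ≤ ∑ W ∈ (Finset.univ : Finset (Finset κ)).filter (fun W => (j - s) + 1 ≤ ∑ k ∈ W, a k), wt[g, W]) :
    x ≤ TERM[s, a, g, j] := by
  rw [term_shift s a g j hsj]
  rw [Finset.sum_filter] at h
  refine h.trans (le_of_eq (Finset.sum_congr rfl fun W _ => ?_))
  split_ifs <;> simp

/-- **λ — one light blob, every floor.**  Gates in `[0,1]`, floor `0 < x < 1`, sure mass `s`, a distinguished blob `x₀` with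
`x² ≤ g x₀ ≤ x` and `a x₀ ≤ j − s`, every other blob with `x ≤ g k`, and `2(j − s) < Σ_{k ≠ x₀} a k·g k + a x₀·(g x₀ − x²)/(1 − x)`.
Then `x ≤ TERM[s, a, g, j]`. [this work] -/
theorem term_ge_of_oneLight (s : ℕ) (a : κ → ℕ) (g : κ → ℝ) (j : ℕ) (x : ℝ) (x₀ : κ) (hx0 : 0 < x) (hx1 : x < 1)
    (hg : ∀ k, 0 ≤ g k ∧ g k ≤ 1) (hheavy : ∀ k, k ≠ x₀ → x ≤ g k) (hgl : x ^ 2 ≤ g x₀) (hgu : g x₀ ≤ x)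
    (hbj : a x₀ ≤ j - s)
    (hcredit : (2 * ((j - s : ℕ) : ℝ)) < (∑ k ∈ Finset.univ.erase x₀, (a k : ℝ) * g k) + a x₀ * ((g x₀ - x ^ 2) / (1 - x))) :
    x ≤ TERM[s, a, g, j] := by
  by_cases hs : j + 1 ≤ s
  · rw [term_eq_one_of_sure s a g j hs]; exact hx1.le
  have hsj : s ≤ j := by omega
  refine term_ge_of_filter_ge s a g j x hsj ?_
  have h := IndepBlob.tail_ge_of_oneLight_allFloors g a x₀ x (j - s) (fun k => (hg k).1) (fun k => (hg k).2) hx0 hx1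
    hheavy hgl hgu hbj (by exact_mod_cast hcredit)
  exact h

/-- **λ⁺ — several sub-floor blobs, all but `x₀` heavy-mergeable at layer `j − s`.**  As `term_ge_of_oneLight`, allowing further blobs
below the floor provided each satisfies `j − s ≤ g k · Σ_{i ≠ x₀, x ≤ g i} a i` (and a heavy blob `i ≠ x₀` of positive size exists); such blobs
enter the credit at FULL rate `a k·g k`. [this work] -/
theorem term_ge_of_heavyMerge_oneLight (s : ℕ) (a : κ → ℕ) (g : κ → ℝ) (j : ℕ) (x : ℝ) (x₀ : κ) (hx0 : 0 < x) (hx1 : x < 1)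
    (hg : ∀ k, 0 ≤ g k ∧ g k ≤ 1) (hgl : x ^ 2 ≤ g x₀) (hgu : g x₀ ≤ x) (hbj : a x₀ ≤ j - s)
    (hM : ∀ k, k ≠ x₀ → g k < x →
      ((j - s : ℕ) : ℝ) ≤ g k * ∑ i ∈ (Finset.univ : Finset κ).filter (fun i => i ≠ x₀ ∧ x ≤ g i), (a i : ℝ))
    (hH : ∀ k, k ≠ x₀ → g k < x → ∃ i, i ≠ x₀ ∧ x ≤ g i ∧ 0 < a i)
    (hcredit : (2 * ((j - s : ℕ) : ℝ)) < (∑ k ∈ Finset.univ.erase x₀, (a k : ℝ) * g k) + a x₀ * ((g x₀ - x ^ 2) / (1 - x))) :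
    x ≤ TERM[s, a, g, j] := by
  by_cases hs : j + 1 ≤ s
  · rw [term_eq_one_of_sure s a g j hs]; exact hx1.le
  have hsj : s ≤ j := by omega
  refine term_ge_of_filter_ge s a g j x hsj ?_
  exact IndepBlob.tail_ge_of_heavyMerge_oneLight g a x₀ x (j - s) (fun k => (hg k).1) (fun k => (hg k).2) hx0 hx1
    hgl hgu hbj hM hH (by exact_mod_cast hcredit)

/-- **υ — the closure union bound as a term certificate.**  Gates in `[0,1]`, `x ≤ 1`, and a family `𝓜` of blob sets such that every
configuration `W` with `Σ_{k∈W} a k ≤ j − s` leaves some `Z ∈ 𝓜` entirely closed; if `x ≤ 1 − Σ_{Z∈𝓜} ∏_{k∈Z} (1 − g k)` then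
`x ≤ TERM[s, a, g, j]`. [this work] -/
theorem term_ge_of_closureUnionBound (s : ℕ) (a : κ → ℕ) (g : κ → ℝ) (j : ℕ) (x : ℝ) (hx1 : x ≤ 1)
    (hg : ∀ k, 0 ≤ g k ∧ g k ≤ 1) (𝓜 : Finset (Finset κ))
    (hcover : ∀ W : Finset κ, ∑ k ∈ W, a k ≤ j - s → ∃ Z ∈ 𝓜, Disjoint Z W)
    (hx : x ≤ 1 - ∑ Z ∈ 𝓜, ∏ k ∈ Z, (1 - g k)) : x ≤ TERM[s, a, g, j] := by
  by_cases hs : j + 1 ≤ s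
  · rw [term_eq_one_of_sure s a g j hs]; exact hx1
  have hsj : s ≤ j := by omega
  refine term_ge_of_filter_ge s a g j x hsj ?_
  exact hx.trans (IndepBlob.tail_ge_one_sub_closureUnionBound g a (fun k => (hg k).1) (fun k => (hg k).2) (j - s) 𝓜 hcover)

end RootDec

end Quant

end Summit.CriticalPhenomena.PercolationContinuityZ3.Theorems
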